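import Mathlib
import Summits.ValiantsHypothesis.ValiantsHypothesis.Theorems.ZeroOneTransfer.Negative.TopComponentFree
import Summits.ValiantsHypothesis.ValiantsHypothesis.Theorems.PerDivisionHard.Negative.PlainBridge
import Summits.ValiantsHypothesis.ValiantsHypothesis.Theorems.DivisionGapPerMultiplesHardStubFaceDescent
import Literature.Computability.AlgebraicComplexity.RealTauConjectureDepthFour
import Literature.Computability.AlgebraicComplexity.ArithCircuitProofs
import Literature.Computability.AlgebraicComplexity.PermanentIrreducible

/-!
# `DivisionGap.PerMultiplesHard` (stmt-ValiantsHypothesis-5068), line `uncharged-face-walk`: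
the line-projection rung, row form (stub `stub_rowConcentration`)

Let `h ≠ 0` be a multiplier over `ℝ≥0` all of whose exponents have total degree `D`, and suppose
some exponent `d₀` of `h` has the `m + 1` columns `A` CONCENTRATED in row `i` (every cell of `d₀`
in a column of `A` lies in row `i`).  Then `m (2^{m-1} - 1) ≤ 2 · L⁺(per_n · h) + 2` for the
tree's monotone fan-in-two `complexity` over `ℝ≥0`.  All moves are free over `ℝ≥0`:

1. TOP FORM for `w = 𝟙{(k,j) : k = i ∨ j ∉ A}` (`topComponent_mul`, `complexity_topComponent_le`):
   the `w`-weight of `x^{μ_σ}` is `#{j : σ j = i ∨ j ∉ A} ≤ n - #A + 1`, with equality when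
   `σ j₁ = i`, `j₁ ∈ A`, so these `x^{μ_σ}` lie in `top_w per_n` (coefficient `1`); the `w`-weight
   of an exponent of `h` is `D -` (its mass off row `i` inside the columns `A`), so every exponent
   of `top_w h` is concentrated (`conc_of_mem_support_topComponent`).
2. ONE PROJECTION onto `m × m` variables (`IsProjection.complexity_le_holds`): row `i` and the
   columns outside `A` ↦ `1`, column `j₁` off row `i` ↦ `0`, the cells `R × (A ∖ j₁)` (`R`: `m` rows
   avoiding `i`) ↦ the `m × m` variables, the rest ↦ `0`.  Then `top_w h ↦ C a`, `a ≠ 0`, and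
   `top_w per_n ↦` a polynomial with the SUPPORT of `per_m` (survivors pass through `(i, j₁)` and
   map `A ∖ j₁` into `R`; every permutation of `Fin m` is induced, `Equiv.Perm.exists_extending_pair`).
3. JERRUM–SNIR BY SUPPORT (`js_le_two_mul_complexity_of_support_eq`): Cor. 3.5 and the content
   bound of §4.3 only see the monomial set, so `m (2^{m-1} - 1) ≤ 2 L⁺(p)` whenever
   `supp p = supp per_m` — no rescaling and no fibre counting (this replaces the scalar identity
   `prj (top_w per_n) = (n-m-1)! • per_m` of the brief).  [folklore]
-/

noncomputable section

open MvPolynomial Literature.Computability.AlgebraicComplexity Literature.Barriers.ValiantsHypothesis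
open scoped NNReal BigOperators
open Summit.ValiantsHypothesis.ValiantsHypothesis.Theorems.ZeroOneTransfer.Negative
open Summit.ValiantsHypothesis.ValiantsHypothesis.Theorems.DivisionGap.PerMultiplesHard.FaceDescent
  (weight_permMonomial permMonomial_mem_support_perPoly sum_coeff_ne_zero)
open Summit.ValiantsHypothesis.Theorems.PerDivisionHardNegative
  (exists_isMonotoneComputation_prodCount_le)

namespace Summit.ValiantsHypothesis.ValiantsHypothesis.Theorems.DivisionGap.PerMultiplesHard.RowConcentration

/-! ### Jerrum–Snir by support, exact form -/

/-- **Jerrum–Snir by support.** JS's lower bound `m (2^{m-1} - 1)` on the `⊗`-count (Cor. 3.5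
with the content bound `δ(r,d) = d!(r-d)!(m-r)!` of §4.3) depends on the target only through its
monomial set, so `m (2^{m-1} - 1) ≤ 2 · L⁺(p)` for every `p` over `ℝ≥0` with the support of
`per_m`, `m ≥ 1`. [cite: JerrumSnir1982, §4.3 and Cor. 3.5] -/
theorem js_le_two_mul_complexity_of_support_eq {m : ℕ} (hm : 1 ≤ m)
    {p : MvPolynomial (Fin m × Fin m) ℝ≥0} (hp : p.support = (perPoly (Fin m) ℝ≥0).support) :
    m * (2 ^ (m - 1) - 1) ≤ 2 * complexity p := by
  obtain ⟨Q, hQ, hc⟩ := exists_isMonotoneComputation_prodCount_le p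
  refine le_trans ?_ hc
  have hperm : ∀ d ∈ p.support, ∃ σ : Equiv.Perm (Fin m), permMonomial σ = d := fun d hd =>
    (JerrumSnir.mem_support_perPoly ℝ≥0).1 (hp ▸ hd)
  have hp0 : ∀ d ∈ p.support, d ≠ 0 := fun d hd => by
    obtain ⟨σ, rfl⟩ := hperm d hd
    exact JerrumSnir.permMonomial_ne_zero hm σ
  have hlin : ∀ d ∈ p.support, ∀ i, d i ≤ 1 := fun d hd i => by
    obtain ⟨σ, rfl⟩ := hperm d hd
    exact JerrumSnir.permMonomial_apply_le_one σ i
  have hN : ∀ d ∈ p.support, d.degree ≤ m := fun d hd => by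
    obtain ⟨σ, rfl⟩ := hperm d hd
    exact (JerrumSnir.degree_permMonomial σ).le
  have hδ : JerrumSnir.ContentBound p (JerrumSnir.perDelta m) :=
    fun A B C a ha b hb hC h => JerrumSnir.contentBound_perPoly m A B C a ha b hb hC
      (fun a' ha' b' hb' c' hc' => hp ▸ h a' ha' b' hb' c' hc')
  have h := JerrumSnir.sum_weight_le_prodCount hQ hp0 hlin hN hδ (JerrumSnir.weightBound_per m)
  rw [hp, JerrumSnir.sum_perWeight_support_perPoly,
    JerrumSnir.factorial_mul_perWeight_eq_natCast hm] at h
  exact_mod_cast h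

/-! ### Indicator weights -/

/-- For an indicator weight `𝟙_P`: weight plus the mass off `P` is the degree. [folklore] -/
theorem weight_indicator_add {α : Type*} (P : α → Prop) [DecidablePred P] (d : α →₀ ℕ) :
    Finsupp.weight (fun e => if P e then 1 else 0) d + ∑ e ∈ d.support with ¬ P e, d e =
      d.degree := by
  rw [Finsupp.weight_apply, Finsupp.degree_apply, Finsupp.sum]
  simp only [smul_eq_mul, mul_ite, mul_one, mul_zero]
  rw [← Finset.sum_filter]
  exact Finset.sum_filter_add_sum_filter_not d.support P (fun e => d e)

/-- The `𝟙_P`-weight equals the degree iff `d` lives on `P`. [folklore] -/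
theorem weight_indicator_eq_degree_iff {α : Type*} (P : α → Prop) [DecidablePred P]
    (d : α →₀ ℕ) :
    Finsupp.weight (fun e => if P e then 1 else 0) d = d.degree ↔ ∀ e ∈ d.support, P e := by
  have h := weight_indicator_add P d
  constructor
  · intro hw e he
    by_contra hP
    have hzero : ∑ e ∈ d.support with ¬ P e, d e = 0 := by omega
    exact (Finsupp.mem_support_iff.1 he)
      (Finset.sum_eq_zero_iff.1 hzero e (Finset.mem_filter.2 ⟨he, hP⟩))
  · intro hall
    have hzero : ∑ e ∈ d.support with ¬ P e, d e = 0 :=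
      Finset.sum_eq_zero fun e he => absurd (hall e (Finset.mem_filter.1 he).1)
        (Finset.mem_filter.1 he).2
    omega

/-- **The top `𝟙_P`-component of a degree-homogeneous `h` with some `P`-supported exponent is
`P`-supported.** [folklore] -/
theorem conc_of_mem_support_topComponent {α : Type*} {h : MvPolynomial α ℝ≥0} {D : ℕ}
    (hdeg : ∀ d ∈ h.support, d.degree = D) (P : α → Prop) [DecidablePred P]
    {d₀ : α →₀ ℕ} (hd₀ : d₀ ∈ h.support) (hconc : ∀ e ∈ d₀.support, P e) {d : α →₀ ℕ}
    (hd : d ∈ (topComponent (fun e => if P e then 1 else 0) h).support) :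
    ∀ e ∈ d.support, P e := by
  have hdh : d ∈ h.support := support_topComponent_subset _ h hd
  rw [mem_support_iff, coeff_topComponent] at hd
  have hwd : Finsupp.weight (fun e => if P e then 1 else 0) d =
      weightedTotalDegree (fun e => if P e then 1 else 0) h := by
    by_contra hne
    rw [if_neg hne] at hd
    exact hd rfl
  rw [← weight_indicator_eq_degree_iff P d]
  refine le_antisymm (le_of_le_of_eq (Nat.le_add_right _ _) (weight_indicator_add P d)) ?_
  rw [hdeg d hdh, ← hdeg d₀ hd₀, ← (weight_indicator_eq_degree_iff P d₀).2 hconc, hwd]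
  exact le_weightedTotalDegree _ hd₀

/-! ### The row-concentration weight on permutation monomials -/

variable {n : ℕ}

/-- For `w = 𝟙{(k,j) : k = i ∨ j ∉ A}` the weight of `x^{μ_σ}` is `#{j : σ j = i ∨ j ∉ A}`, at most
`n - #A + 1` (at most one column `j` has `σ j = i`). [folklore] -/
theorem weight_conc_permMonomial_le (i : Fin n) (A : Finset (Fin n)) (σ : Equiv.Perm (Fin n)) :
    Finsupp.weight (fun e : Fin n × Fin n => if e.1 = i ∨ e.2 ∉ A then 1 else 0)
        (permMonomial σ) ≤ n - A.card + 1 := by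
  rw [weight_permMonomial, ← Finset.card_filter]
  calc (Finset.univ.filter fun j => σ j = i ∨ j ∉ A).card
      ≤ (insert (σ.symm i) Aᶜ).card := by
        refine Finset.card_le_card fun j hj => ?_
        rw [Finset.mem_insert, Finset.mem_compl]
        rcases (Finset.mem_filter.1 hj).2 with h | h
        · left
          rw [← h, Equiv.symm_apply_apply]
        · exact Or.inr h
    _ ≤ Aᶜ.card + 1 := Finset.card_insert_le _ _
    _ = n - A.card + 1 := by rw [Finset.card_compl, Fintype.card_fin]

/-- If `σ j₁ = i` with `j₁ ∈ A`, the weight is exactly `n - #A + 1`. [folklore] -/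
theorem weight_conc_permMonomial_eq (i : Fin n) (A : Finset (Fin n)) (σ : Equiv.Perm (Fin n))
    {j₁ : Fin n} (hj₁ : j₁ ∈ A) (hσ : σ j₁ = i) :
    Finsupp.weight (fun e : Fin n × Fin n => if e.1 = i ∨ e.2 ∉ A then 1 else 0)
        (permMonomial σ) = n - A.card + 1 := by
  rw [weight_permMonomial, ← Finset.card_filter]
  have hset : (Finset.univ.filter fun j => σ j = i ∨ j ∉ A) = insert j₁ Aᶜ := by
    ext j
    simp only [Finset.mem_filter, Finset.mem_univ, true_and, Finset.mem_insert, Finset.mem_compl]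
    constructor
    · rintro (h | h)
      · exact Or.inl (σ.injective (h.trans hσ.symm))
      · exact Or.inr h
    · rintro (rfl | h)
      · exact Or.inl hσ
      · exact Or.inr h
  rw [hset, Finset.card_insert_of_notMem (fun h => Finset.mem_compl.1 h hj₁), Finset.card_compl,
    Fintype.card_fin]

/-- Hence the top `w`-weight of `per_n` is `n - #A + 1` (attained at the transposition `(i j₁)`),
and every permutation through `(i, j₁)`, `j₁ ∈ A`, occurs in `top_w per_n` with coefficient `1`.
[folklore] -/
theorem coeff_topComponent_perPoly_eq_one (i : Fin n) (A : Finset (Fin n)) {j₁ : Fin n}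
    (hj₁ : j₁ ∈ A) {σ : Equiv.Perm (Fin n)} (hσ : σ j₁ = i) :
    coeff (permMonomial σ) (topComponent
      (fun e : Fin n × Fin n => if e.1 = i ∨ e.2 ∉ A then 1 else 0) (perPoly (Fin n) ℝ≥0)) = 1 := by
  have htop : weightedTotalDegree (fun e : Fin n × Fin n => if e.1 = i ∨ e.2 ∉ A then 1 else 0)
      (perPoly (Fin n) ℝ≥0) = n - A.card + 1 := by
    refine le_antisymm (Finset.sup_le fun d hd => ?_) ?_
    · obtain ⟨τ, rfl⟩ :=
        exists_permMonomial_eq_of_coeff_perPoly_ne_zero ℝ≥0 (mem_support_iff.1 hd)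
      exact weight_conc_permMonomial_le i A τ
    · rw [← weight_conc_permMonomial_eq i A (Equiv.swap i j₁) hj₁ (Equiv.swap_apply_right i j₁)]
      exact le_weightedTotalDegree _ (permMonomial_mem_support_perPoly _)
  rw [coeff_topComponent, htop, weight_conc_permMonomial_eq i A σ hj₁ hσ, if_pos rfl,
    coeff_permMonomial_perPoly]

/-- The exponents of any top component of `per_n` are permutation monomials, with coefficient
`1`. [folklore] -/
theorem coeff_topComponent_perPoly_of_mem (w : Fin n × Fin n → ℕ) {d : Fin n × Fin n →₀ ℕ}
    (hd : d ∈ (topComponent w (perPoly (Fin n) ℝ≥0)).support) :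
    coeff d (topComponent w (perPoly (Fin n) ℝ≥0)) = 1 ∧
      ∃ τ : Equiv.Perm (Fin n), permMonomial τ = d := by
  have hd' := support_topComponent_subset w _ hd
  obtain ⟨τ, rfl⟩ := exists_permMonomial_eq_of_coeff_perPoly_ne_zero ℝ≥0 (mem_support_iff.1 hd')
  refine ⟨?_, τ, rfl⟩
  rw [mem_support_iff, coeff_topComponent] at hd
  rw [coeff_topComponent]
  by_cases h : Finsupp.weight w (permMonomial τ) = weightedTotalDegree w (perPoly (Fin n) ℝ≥0)
  · rw [if_pos h, coeff_permMonomial_perPoly]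
  · rw [if_neg h] at hd
    exact absurd rfl hd

/-- `x^{μ_σ} = ∏_j x_{(σ j, j)}`. [folklore] -/
theorem monomial_permMonomial {ι : Type*} [Fintype ι] [DecidableEq ι] (σ : Equiv.Perm ι) :
    (monomial (permMonomial σ) (1 : ℝ≥0) : MvPolynomial (ι × ι) ℝ≥0) = ∏ j, X (σ j, j) := by
  rw [permMonomial, monomial_sum_one]
  rfl

/-! ### The stub -/

/-- **Line projection, row form** (stub `stub_rowConcentration` of line `uncharged-face-walk`).
If `h ≠ 0` is homogeneous in total degree and some exponent of `h` has the `m + 1` columns `A`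
concentrated in row `i`, then `m (2^{m-1} - 1) ≤ 2 · L⁺(per_n · h) + 2`: one free top form
(`w = 𝟙{k = i ∨ j ∉ A}`), one free projection onto `m × m` variables under which the cofactor
becomes a nonzero constant and the permanent a polynomial with the support of `per_m`, then
Jerrum–Snir by support. [cite: JerrumSnir1982, §4.3] -/
theorem stub_rowConcentration :
    ∀ (n : ℕ) (h : MvPolynomial (Fin n × Fin n) ℝ≥0), h ≠ 0 →
      ∀ (D : ℕ), (∀ d ∈ h.support, d.degree = D) →
      ∀ (i : Fin n) (A : Finset (Fin n)) (m : ℕ),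
        (∃ d₀ ∈ h.support, ∀ e ∈ d₀.support, e.2 ∈ A → e.1 = i) →
        A.card = m + 1 → 1 ≤ m →
        m * (2 ^ (m - 1) - 1) ≤ 2 * complexity (perPoly (Fin n) ℝ≥0 * h) + 2 := by
  intro n h hh D hdeg i A m hconc hA hm
  classical
  obtain ⟨d₀, hd₀, hd₀c⟩ := hconc
  -- the weight; the top form of `h` is concentrated
  set w : Fin n × Fin n → ℕ := fun e => if e.1 = i ∨ e.2 ∉ A then 1 else 0 with hw
  set per := perPoly (Fin n) ℝ≥0 with hper
  have hconcT : ∀ d ∈ (topComponent w h).support, ∀ e ∈ d.support, e.1 = i ∨ e.2 ∉ A :=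
    fun d hd => conc_of_mem_support_topComponent hdeg (fun e => e.1 = i ∨ e.2 ∉ A) hd₀
      (fun e he => (em (e.2 ∈ A)).imp (hd₀c e he) id) hd
  -- a column `j₁ ∈ A`, the other columns `A'`, a set `R` of `m` rows avoiding `i`
  obtain ⟨j₁, hj₁⟩ : A.Nonempty := Finset.card_pos.1 (by omega)
  set A' := A.erase j₁ with hA'def
  have hA' : A'.card = m := by rw [hA'def, Finset.card_erase_of_mem hj₁, hA, Nat.add_sub_cancel]
  have hroom : m ≤ (Finset.univ.erase i).card := by
    have := hA ▸ Finset.card_le_univ A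
    rw [Finset.card_erase_of_mem (Finset.mem_univ i), Finset.card_univ, Fintype.card_fin] at *
    omega
  obtain ⟨R, hRsub, hR⟩ := Finset.exists_subset_card_eq hroom
  have hiR : i ∉ R := fun h => (Finset.mem_erase.1 (hRsub h)).1 rfl
  -- enumerations of `A'` and `R` by `Fin m`, with left inverses
  obtain ⟨fA, hfAinj, hfAmem, himA⟩ : ∃ f : Fin m → Fin n, Function.Injective f ∧
      (∀ t, f t ∈ A') ∧ Finset.univ.image f = A' :=
    ⟨A'.orderEmbOfFin hA', (A'.orderEmbOfFin hA').injective, A'.orderEmbOfFin_mem hA',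
      A'.image_orderEmbOfFin_univ hA'⟩
  obtain ⟨fR, hfRinj, hfRmem, himR⟩ : ∃ f : Fin m → Fin n, Function.Injective f ∧
      (∀ t, f t ∈ R) ∧ Finset.univ.image f = R :=
    ⟨R.orderEmbOfFin hR, (R.orderEmbOfFin hR).injective, R.orderEmbOfFin_mem hR,
      R.image_orderEmbOfFin_univ hR⟩
  have hfAsurj : ∀ j ∈ A', ∃ t, fA t = j := fun j hj => by
    simpa using (show j ∈ Finset.univ.image fA by rw [himA]; exact hj)
  have hfRsurj : ∀ k ∈ R, ∃ t, fR t = k := fun k hk => by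
    simpa using (show k ∈ Finset.univ.image fR by rw [himR]; exact hk)
  haveI : Nonempty (Fin m) := ⟨⟨0, hm⟩⟩
  obtain ⟨bA, hbA⟩ : ∃ g : Fin n → Fin m, ∀ t, g (fA t) = t :=
    ⟨Function.invFun fA, Function.leftInverse_invFun hfAinj⟩
  obtain ⟨bR, hbR⟩ : ∃ g : Fin n → Fin m, ∀ t, g (fR t) = t :=
    ⟨Function.invFun fR, Function.leftInverse_invFun hfRinj⟩
  -- the projection, by specification
  obtain ⟨prj, hp1, hp0, hpX, hpP⟩ :
      ∃ prj : Fin n × Fin n → MvPolynomial (Fin m × Fin m) ℝ≥0,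
        (∀ e, e.1 = i ∨ e.2 ∉ A → prj e = 1) ∧
        (∀ k j, j ∈ A → k ≠ i → ¬ (j ≠ j₁ ∧ k ∈ R) → prj (k, j) = 0) ∧
        (∀ k j, j ∈ A' → k ∈ R → prj (k, j) = X (bR k, bA j)) ∧
        ∀ e, (∃ v, prj e = X v) ∨ ∃ c, prj e = C c := by
    refine ⟨fun e => if e.1 = i ∨ e.2 ∉ A then 1 else
      if e.2 ≠ j₁ ∧ e.1 ∈ R then X (bR e.1, bA e.2) else 0, fun e he => if_pos he,
      fun k j hj hk hkj => ?_, fun k j hj hk => ?_, fun e => ?_⟩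
    · dsimp only
      rw [if_neg (not_or.2 ⟨hk, not_not_intro hj⟩), if_neg hkj]
    · have hki : k ≠ i := fun h => hiR (h ▸ hk)
      dsimp only
      rw [if_neg (not_or.2 ⟨hki, not_not_intro (Finset.mem_of_mem_erase hj)⟩),
        if_pos ⟨Finset.ne_of_mem_erase hj, hk⟩]
    · dsimp only
      split_ifs
      · exact Or.inr ⟨1, C_1.symm⟩
      · exact Or.inl ⟨_, rfl⟩
      · exact Or.inr ⟨0, C_0.symm⟩
  -- the cofactor becomes a nonzero constant
  have ha0 : ∑ d ∈ (topComponent w h).support, coeff d (topComponent w h) ≠ 0 :=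
    sum_coeff_ne_zero (topComponent_ne_zero w hh)
  have htopH : aeval prj (topComponent w h) =
      C (∑ d ∈ (topComponent w h).support, coeff d (topComponent w h)) := by
    conv_lhs => rw [(topComponent w h).as_sum]
    rw [map_sum, map_sum]
    refine Finset.sum_congr rfl fun d hd => ?_
    rw [aeval_monomial, algebraMap_eq]
    suffices hp : (d.prod fun v k => prj v ^ k) = 1 by rw [hp, mul_one]
    refine Finset.prod_eq_one fun v hv => ?_
    show prj v ^ d v = 1
    rw [hp1 v (hconcT d hd v hv), one_pow]
  -- the permanent: a sum over the permutation monomials of its top form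
  have htopP : aeval prj (topComponent w per) =
      ∑ d ∈ (topComponent w per).support, aeval prj (monomial d (1 : ℝ≥0)) := by
    conv_lhs => rw [(topComponent w per).as_sum]
    rw [map_sum]
    exact Finset.sum_congr rfl fun d hd => by rw [(coeff_topComponent_perPoly_of_mem w hd).1]
  have hmon : ∀ σ : Equiv.Perm (Fin n),
      aeval prj (monomial (permMonomial σ) (1 : ℝ≥0)) = ∏ j, prj (σ j, j) := fun σ => by
    rw [monomial_permMonomial, map_prod]
    simp only [aeval_X]
  -- non-survivors vanish
  have hzero : ∀ σ : Equiv.Perm (Fin n), ¬ (σ j₁ = i ∧ ∀ j ∈ A', σ j ∈ R) →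
      aeval prj (monomial (permMonomial σ) (1 : ℝ≥0)) = 0 := by
    intro σ hσ
    rw [hmon]
    by_cases h1 : σ j₁ = i
    · obtain ⟨j, hj⟩ := not_forall.1 (fun hall => hσ ⟨h1, hall⟩)
      obtain ⟨hjA', hjR⟩ := Classical.not_imp.1 hj
      have hne : σ j ≠ i := fun h =>
        Finset.ne_of_mem_erase hjA' (σ.injective (h.trans h1.symm))
      exact Finset.prod_eq_zero (Finset.mem_univ j)
        (hp0 _ _ (Finset.mem_of_mem_erase hjA') hne (fun h => hjR h.2))
    · exact Finset.prod_eq_zero (Finset.mem_univ j₁) (hp0 _ _ hj₁ h1 (fun h => h.1 rfl))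
  -- survivors project onto the monomial of the permutation of `Fin m` they induce
  have hgood : ∀ σ : Equiv.Perm (Fin n), σ j₁ = i → (∀ j ∈ A', σ j ∈ R) →
      ∃ π : Equiv.Perm (Fin m), (∀ t, fR (π t) = σ (fA t)) ∧
        aeval prj (monomial (permMonomial σ) (1 : ℝ≥0)) = monomial (permMonomial π) 1 := by
    intro σ h1 h2
    have hex : ∀ t, ∃ s, fR s = σ (fA t) := fun t => hfRsurj _ (h2 _ (hfAmem t))
    choose g hg using hex
    have hginj : Function.Injective g := fun t t' htt' =>
      hfAinj (σ.injective (by rw [← hg t, ← hg t', htt']))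
    refine ⟨Equiv.ofBijective g (Finite.injective_iff_bijective.1 hginj), fun t => hg t, ?_⟩
    rw [hmon, monomial_permMonomial]
    have step1 : ∏ j, prj (σ j, j) = ∏ j, (if j ∈ A' then X (bR (σ j), bA j) else 1) := by
      refine Finset.prod_congr rfl fun j _ => ?_
      by_cases hjA' : j ∈ A'
      · rw [if_pos hjA', hpX _ _ hjA' (h2 j hjA')]
      · rw [if_neg hjA']
        refine hp1 _ ((em (j ∈ A)).imp (fun hjA => ?_) id)
        have hjj : j = j₁ := by
          by_contra hne
          exact hjA' (Finset.mem_erase.2 ⟨hne, hjA⟩)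
        rw [hjj, h1]
    rw [step1, Fintype.prod_ite_mem, ← himA, Finset.prod_image hfAinj.injOn]
    refine Finset.prod_congr rfl fun t _ => ?_
    rw [hbA, Equiv.ofBijective_apply, ← hg t, hbR]
  -- every permutation of `Fin m` is induced by a survivor
  have hext : ∀ ρ : Equiv.Perm (Fin m), ∃ σ : Equiv.Perm (Fin n),
      σ j₁ = i ∧ ∀ t, σ (fA t) = fR (ρ t) := by
    intro ρ
    have hf : Function.Injective (Sum.elim (fun _ : Unit => j₁) fA) :=
      (Function.injective_of_subsingleton _).sumElim hfAinj fun _ t (h : j₁ = fA t) =>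
        Finset.ne_of_mem_erase (hfAmem t) h.symm
    have hg : Function.Injective (Sum.elim (fun _ : Unit => i) (fun t => fR (ρ t))) :=
      (Function.injective_of_subsingleton _).sumElim (hfRinj.comp ρ.injective)
        fun _ t (h : i = fR (ρ t)) => hiR (by rw [h]; exact hfRmem (ρ t))
    obtain ⟨σ, hσ⟩ := Equiv.Perm.exists_extending_pair _ _ hf hg
    exact ⟨σ, hσ (Sum.inl ()), fun t => hσ (Sum.inr t)⟩
  -- so the projected top form of the permanent has the support of `per_m`
  set S := ∑ d ∈ (topComponent w per).support, aeval prj (monomial d (1 : ℝ≥0)) with hS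
  have hSsupp : S.support = (perPoly (Fin m) ℝ≥0).support := by
    ext d'
    constructor
    · intro hd'
      obtain ⟨d, hd, hd'd⟩ := Finset.mem_biUnion.1 (support_sum hd')
      obtain ⟨-, τ, rfl⟩ := coeff_topComponent_perPoly_of_mem w hd
      by_cases hg : τ j₁ = i ∧ ∀ j ∈ A', τ j ∈ R
      · obtain ⟨π, -, hπ⟩ := hgood τ hg.1 hg.2
        rw [hπ] at hd'd
        rw [Finset.mem_singleton.1 (support_monomial_subset hd'd)]
        exact permMonomial_mem_support_perPoly π
      · rw [hzero τ hg, support_zero] at hd'd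
        exact absurd hd'd (Finset.notMem_empty _)
    · intro hd'
      obtain ⟨ρ, rfl⟩ :=
        exists_permMonomial_eq_of_coeff_perPoly_ne_zero ℝ≥0 (mem_support_iff.1 hd')
      obtain ⟨σ, h1, h2⟩ := hext ρ
      have hg2 : ∀ j ∈ A', σ j ∈ R := fun j hj => by
        obtain ⟨t, rfl⟩ := hfAsurj j hj
        exact (h2 t).symm ▸ hfRmem _
      obtain ⟨π, hπ1, hπ2⟩ := hgood σ h1 hg2
      have hπρ : π = ρ := Equiv.ext fun t => hfRinj ((hπ1 t).trans (h2 t))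
      have hmem : permMonomial σ ∈ (topComponent w per).support := by
        rw [mem_support_iff, coeff_topComponent_perPoly_eq_one i A hj₁ h1]
        exact one_ne_zero
      have hle : coeff (permMonomial ρ) (aeval prj (monomial (permMonomial σ) (1 : ℝ≥0))) ≤
          ∑ d ∈ (topComponent w per).support,
            coeff (permMonomial ρ) (aeval prj (monomial d (1 : ℝ≥0))) :=
        Finset.single_le_sum_of_canonicallyOrdered
          (f := fun d => coeff (permMonomial ρ) (aeval prj (monomial d (1 : ℝ≥0)))) hmem
      rw [hπ2, hπρ, coeff_monomial, if_pos rfl] at hle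
      rw [mem_support_iff, hS, coeff_sum]
      exact ne_of_gt (lt_of_lt_of_le one_pos hle)
  -- assemble: top form (free), projection (free), Jerrum–Snir by support
  have hsuppG : (aeval prj (topComponent w (per * h))).support =
      (perPoly (Fin m) ℝ≥0).support := by
    rw [topComponent_mul, map_mul, htopP, htopH, mul_comm, ← smul_eq_C_mul,
      JerrumSnir.support_smul_eq ha0, hSsupp]
  have h1 : complexity (aeval prj (topComponent w (per * h))) ≤
      complexity (topComponent w (per * h)) :=
    IsProjection.complexity_le_holds ⟨prj, hpP, rfl⟩
  have h2 := complexity_topComponent_le w (per * h)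
  exact (js_le_two_mul_complexity_of_support_eq hm hsuppG).trans (by omega)

end Summit.ValiantsHypothesis.ValiantsHypothesis.Theorems.DivisionGap.PerMultiplesHard.RowConcentration

end
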